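import Literature.NumberTheory.EllipticCurves.X049SevenTorsionFrobenius
import Literature.NumberTheory.EllipticCurves.X049GroupOrderUpToSign
import Literature.NumberTheory.EllipticCurves.X049TwistFamily
import HarnessLib

/-!
# The group order formula for `X₀(49)` is a theorem; `L(E, s)` is entire for every `E/ℚ` with `j = −3375` — unconditionally

Topic `Literature/NumberTheory/EllipticCurves`, namespace `Literature.NumberTheory.EllipticCurves.X049` (capstone of the `X049*` series:
`X049GroupOrderUpToSign` proved Silverberg's formula up to the sign and reduced the named fact `groupOrder_A7` to the sign rule
«`(a_p/7) = +1` whenever `4p = u² + 7v²`» (`groupOrder_A7_iff_sign`); `X049SevenTorsionFrobenius` proves `a_p ≡ p⁵ + p² (mod 7)` by the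
`√−7`-torsion Frobenius argument).  THEOREMS ONLY.

* `jacobiSym_frobeniusTrace_E` — for every prime `p ≠ 7` with `4p = u² + 7v²`: `(a_p(E)/7) = 1` (`p = 2`: `a₂ = 1`; `p` odd: `p mod 7 ∈ {1,2,4}`
  and `a_p mod 7 = 2, 1, 4` respectively, all squares mod `7`);
* ★★ `groupOrder_A7_holds : groupOrder_A7` — Silverberg 2010 (2.1) / Rajwade 1977 Thm. 3 for `d = 7` is a THEOREM of the tree (debt −1);
* ★★★ `hasEntireLFunction_of_j_eq_neg3375_holds` — `L(W, s)` has an entire continuation for EVERY elliptic curve `W/ℚ` with `j(W) = −3375`,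
  UNCONDITIONALLY: the `j = −3375` row of the Deuring–Hecke leaf `hasEntireLFunction_of_j_mem_maximalCMJInvariants`
  (`X049TwistFamily.hasEntireLFunction_of_j_eq_neg3375` with its one printed input now proved).

References: Silverberg, Contemp. Math. 521 (2010), (2.1), Table 1; Rajwade, J. Number Theory 9 (1977), Thm. 3; Silverman *AEC* V.2.3.1.
-/

noncomputable section

open scoped Classical NumberField

namespace Literature.NumberTheory.EllipticCurves

namespace X049

open _root_.WeierstrassCurve Literature.NumberTheory.Automorphic

/-- ★ **The sign rule for `X₀(49)`: `(a_p(E)/7) = +1`** for every prime `p ≠ 7` at which `4p = u² + 7v²` is soluble (the split primes and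
`p = 2`).  From `frobeniusTrace_E_mod_seven` (`a_p ≡ p⁵ + p² (mod 7)`, the `√−7`-torsion Frobenius argument) and
`mod_seven_of_sq_add_seven_mul_sq` (`p mod 7 ∈ {1, 2, 4}`): `a_p mod 7 ∈ {2, 1, 4}`, squares mod `7`; at `p = 2`, `a₂ = 1`.
[cite: Rajwade1977, Thm 3] [cite: Silverberg2010, (2.1)] -/
theorem jacobiSym_frobeniusTrace_E {p : ℕ} (hp : p.Prime) (hp7 : p ≠ 7) {u v : ℤ} (huv : u ^ 2 + 7 * v ^ 2 = 4 * p) :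
    jacobiSym (frobeniusTrace E p) 7 = 1 := by
  by_cases hp2 : p = 2
  · subst hp2
    rw [Automorphic.frobeniusTrace, numPointsMod_two]
    norm_num
  · have hr := mod_seven_of_sq_add_seven_mul_sq hp hp7 huv
    have hmod := frobeniusTrace_E_mod_seven hp hp2 hp7
    have hm : frobeniusTrace E p % 7 = 2 ∨ frobeniusTrace E p % 7 = 1 ∨ frobeniusTrace E p % 7 = 4 := by
      rcases hr with h | h | h
      · rw [if_pos h] at hmod; exact Or.inl hmod
      · rw [if_neg (by omega), if_pos h] at hmod; exact Or.inr (Or.inl hmod)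
      · rw [if_neg (by omega), if_neg (by omega), if_pos h] at hmod; exact Or.inr (Or.inr hmod)
    rw [jacobiSym.mod_left (frobeniusTrace E p) 7]
    simp only [Nat.cast_ofNat]
    rcases hm with h | h | h <;> rw [h] <;> norm_num

/-- ★★ **The group order formula for `A(7) = X₀(49)`, DISCHARGED**: the named fact `groupOrder_A7` of `X049FrobeniusTraces` holds — for
every prime `p ≠ 7` and all `u, v ∈ ℤ` with `u² + 7v² = 4p`, `#E(𝔽_p) = p + 1 − (2u/7)·u` (Silverberg 2010, (2.1); Rajwade 1977, Thm. 3):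
`groupOrder_A7_iff_sign` (the formula up to sign, `X049GroupOrderUpToSign`) and the sign rule `jacobiSym_frobeniusTrace_E`.
[cite: Silverberg2010, (2.1) and Table 1 (d = 7)] [cite: Rajwade1977, Thm 3] -/
theorem groupOrder_A7_holds : groupOrder_A7 :=
  groupOrder_A7_iff_sign.mpr fun _ hp hp7 _ _ huv ↦ jacobiSym_frobeniusTrace_E hp hp7 huv

/-- ★★★ **`L(W, s)` has an entire continuation for every elliptic curve `W/ℚ` with `j(W) = −3375` — UNCONDITIONAL.**  The `j = −3375`
row (CM by `ℤ[½(1+√−7)]`) of the Deuring–Hecke leaf `hasEntireLFunction_of_j_mem_maximalCMJInvariants`: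
`X049TwistFamily.hasEntireLFunction_of_j_eq_neg3375` (theta series of `ℚ(√−7)`) with `groupOrder_A7` proved (`groupOrder_A7_holds`).
[cite: SilvermanATAEC1994, II Cor. 10.5.1] [cite: Silverberg2010, (2.1)] -/
theorem hasEntireLFunction_of_j_eq_neg3375_holds (W : WeierstrassCurve ℚ) [W.IsElliptic] (hj : W.j = -3375) :
    W.HasEntireLFunction :=
  hasEntireLFunction_of_j_eq_neg3375 groupOrder_A7_holds W hj

end X049

end Literature.NumberTheory.EllipticCurves
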